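import Summits.CriticalPhenomena.PercolationContinuityZ3.Theorems.PercNearOneGluingNoHeavyQuantIndepBlobFar
import Summits.CriticalPhenomena.PercolationContinuityZ3.Theorems.PercNearOneGluingNoHeavyQuantBinomialToolkit
import HarnessLib

/-!
# QUANT lane R8: the DISCOUNTED-HYPOTHESIS / UPGRADED-CONCLUSION block-star row — the binomial core of FAR on the
# one-block loose-hub tree family (first branching family beyond stars, block-stars and spiders)

builds on p205010 (kernel theorem, internal audit signed; external expert review pending)

Support file (`--supports stmt-CriticalPhenomena-4575`), seat `prim-quant-census-1` (gen 7); memo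
`run/shared/lean/prim/quant/prim-quant-census-1/FAR-LOOSE-HUB-ONE-BLOCK.md` (= evidence `FAR-LOOSE-HUB-ONE-BLOCK.md` on stmt-4575) and
`CENSUS-GAIN.md` §15.1; answers lead g6's LEAD-NOTES-G6 N14 (4)/(4b) ('GX′/DSR′ with one light block') for EQUAL units.
No definitions (two `local notation`s for the binomial pmf/cdf; the elementary binomial facts are in `…QuantBinomialToolkit.lean`), no named facts, no sorries; standard axioms.

THE ROW (`QuantCensus.DiscountRow.discounted_blockStar_row`).  Block-star with `c` glued units, one blob of `a` relays behind a gate of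
weight `g`, and `m` unit relays behind gates of a common weight `u ≥ g`; layer `j` with `c ≤ j`, `a ≤ j`.  If the mean computed with the
units DISCOUNTED to the blob gate exceeds `2j`,
        `c + g·(m + a) > 2j`,
then  `P(c + a·ε_g + Bin(m,u) ≥ j+1) ≥ u`  — the conclusion of the independent-blob half-mean inequality N12
(`Quant.IndepBlob.far_indepBlob`, p216624: `≥` the LEAST gate `g`) is upgraded to the NEXT gate `u`.  N12 is the case `u = g`.  Written with
the number `C ~ Bin(m, 1−u)` of CLOSED units and `n₀ := m − (j−c) − 1`:  `{count ≥ j+1} = {C ≤ n₀ + a·[blob open]}`, so the row reads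
`u ≤ g·P(C ≤ n₀ + a) + (1−g)·P(C ≤ n₀)`.

WHY IT MATTERS (memo §0–§1).  On the depth-two tree 'root + one blob (a, g) + one hub (gate G) carrying c glued relays and m loose
leaves of weight u' the far-relay row FAR (`Quant.FarRelayRow`, OPEN in general) reduces — by the shift of glued root relays, the
trivial big-blob case, two affine reductions in the hub gate and in the blob gate, and N12 when `g ≥ u` — to exactly this row at the tie
`G·u = g` (its hypothesis `g(c/u + m + a) > 2j` implies `c + g(m+a) > 2j`).  That tree family contains the V97 threshold geometry
(`QuantCensus.farRelayRow_factor_two_sharp`, p220393) and is the first BRANCHING family on which FAR is established; the percolation-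
vocabulary statement follows from this file by the tree↔gate transfer `Quant.tree_relayCount_transfer` (p219638) and is left to the typer.

PROOF (all discrete; `s := j − c`, `m = n₀ + s + 1`):
* CASE A (`a ≥ s+1`, `row_caseA`): the blob alone exceeds the level; Markov on the closed units, `P(C ≥ n₀+1) ≤ m(1−u)/(n₀+1)`, and
  `g·m ≥ s`.
* CASE B (`a ≤ s`, `m ≥ a+2`, `row_caseB`): GATE MIXTURE — a `Bern(u)` unit is 'glued' with probability `1−λ` and a `Bern(g)` unit with
  probability `λ := (1−u)/(1−g)` (thinning, `bcdf_thin`), so the target equals `E F(K)`, `K ~ Bin(m,λ)`,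
  `F(K) := g·P(Bin(K,1−g) ≤ n₀+a) + (1−g)·P(Bin(K,1−g) ≤ n₀)` ('K loose units at gate g, m−K glued'); `F(0) = 1`, `F(m) ≥ g` by N12 at
  the all-`g` point (`n12_point`, from `far_indepBlob` on `Fin m`); the decrements `F(K) − F(K+1) = (1−g)·[g·P(Bin(K,1−g) = n₀+a) +
  (1−g)·P(Bin(K,1−g) = n₀)]` (`bcdf_succ`) are NON-DECREASING for `K ≤ m−2` because `(m−1)(1−g) ≤ n₀ ⟸ g > 2s/(m+a) ≥ s/(m−1)`
  (`bpmf_le_succ`), so `F` is discretely CONCAVE and lies above its chord (`chord_of_concave`):  `E F(K) ≥ 1 − (EK/m)(1 − F(m)) =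
  1 − λ(1 − F(m)) ≥ 1 − λ(1−g) = u`.
* CASE C (`a = s`, `m = s+1`, the V97 shape, `row_caseC`): closed forms `1 − (1−u)^{s+1}`, `u^{s+1}`, Bernoulli's inequality and
  `(1−g)(s+2) < 1 ⟸ g > 2s/(2s+1)`.
Every step was re-checked in exact rational arithmetic before typing (memo; `code/gen7/verify_core_proof.py`, 1 732 random instances).
[cite: KozmaNitzan2024, Lemma 2 (p. 6), Conjecture 3 (p. 15)]
-/

open Finset

namespace Summit.CriticalPhenomena.PercolationContinuityZ3.Theorems

namespace QuantCensus.DiscountRow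


/-- binomial pmf `P(Bin(K,q) = n)` -/
local notation3 "bpmf[" K ", " n ", " q "]" => (((Nat.choose K n : ℕ) : ℝ) * q ^ n * (1 - q) ^ (K - n))
/-- binomial cdf `P(Bin(K,q) ≤ n)` -/
local notation3 "bcdf[" K ", " n ", " q "]" => (∑ i ∈ Finset.range (n + 1), ((Nat.choose K i : ℕ) : ℝ) * q ^ i * (1 - q) ^ (K - i))

/-! ### The discounted block-star row: case B (discrete concavity) and case A (Markov), abstract forms -/

/-- **Case B.**  Units `m = n₀ + s + 1`, closed-count thresholds `n₀` (block closed) and `n₀ + a` (block open), block gate `g`.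
If `(m−1)(1−g) ≤ n₀` (concavity) and the all-`g` system satisfies `g ≤ P_g` (N12), then for every `u ∈ [g, 1]`:
`u ≤ P_u := g·P(Bin(m,1−u) ≤ n₀+a) + (1−g)·P(Bin(m,1−u) ≤ n₀)`. -/
theorem row_caseB (n₀ s a : ℕ) {g u : ℝ} (hg0 : 0 ≤ g) (hgu : g ≤ u) (hu1 : u ≤ 1)
    (hconc : ((n₀ + s + 1 : ℕ) - 1 : ℝ) * (1 - g) ≤ n₀)
    (hN12 : g ≤ g * bcdf[n₀ + s + 1, n₀ + a, 1 - g] + (1 - g) * bcdf[n₀ + s + 1, n₀, 1 - g]) :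
    u ≤ g * bcdf[n₀ + s + 1, n₀ + a, 1 - u] + (1 - g) * bcdf[n₀ + s + 1, n₀, 1 - u] := by
  set m : ℕ := n₀ + s + 1 with hm
  rcases eq_or_lt_of_le (le_trans hgu hu1) with hg1 | hg1
  · -- g = 1 forces u = 1
    have hu : u = 1 := le_antisymm hu1 (hg1 ▸ hgu)
    subst hu
    rw [sub_self]
    have h1 : bcdf[m, n₀ + a, (0:ℝ)] = 1 := by
      rw [Finset.sum_eq_single 0]
      · simp
      · intro i _ hi; simp [zero_pow hi]
      · intro h; simp at h
    have h2 : bcdf[m, n₀, (0:ℝ)] = 1 := by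
      rw [Finset.sum_eq_single 0]
      · simp
      · intro i _ hi; simp [zero_pow hi]
      · intro h; simp at h
    rw [h1, h2]; linarith
  -- g < 1: the gate mixture with λ = (1-u)/(1-g)
  have hgbar : 0 < 1 - g := by linarith
  set lam : ℝ := (1 - u) / (1 - g) with hlam
  have hlam0 : 0 ≤ lam := div_nonneg (by linarith) hgbar.le
  have hlam1 : lam ≤ 1 := by rw [hlam, div_le_one hgbar]; linarith
  have hul : 1 - u = lam * (1 - g) := by rw [hlam]; field_simp
  -- F(K) := g·bcdf[K, n₀+a, ḡ] + ḡ·bcdf[K, n₀, ḡ]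
  set F : ℕ → ℝ := fun K => g * bcdf[K, n₀ + a, 1 - g] + (1 - g) * bcdf[K, n₀, 1 - g] with hF
  have hF0 : F 0 = 1 := by simp only [hF, bcdf_zero_left]; ring
  have hFm : g ≤ F m := hN12
  -- mixture identity: P_u = ∑_K bpmf[m,K,lam] * F K
  have hmix : g * bcdf[m, n₀ + a, 1 - u] + (1 - g) * bcdf[m, n₀, 1 - u] =
      ∑ K ∈ Finset.range (m + 1), bpmf[m, K, lam] * F K := by
    rw [hul, bcdf_thin, bcdf_thin, Finset.mul_sum, Finset.mul_sum, ← Finset.sum_add_distrib]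
    refine Finset.sum_congr rfl fun K _ => ?_
    simp only [hF]; ring
  -- concavity of F: decrements F K - F (K+1) = (1-g) * π K with π non-decreasing for K+1 ≤ m-1
  have hdec : ∀ K, F K - F (K + 1) = (1 - g) * (g * bpmf[K, n₀ + a, 1 - g] + (1 - g) * bpmf[K, n₀, 1 - g]) := by
    intro K
    simp only [hF]
    rw [bcdf_succ K (n₀ + a) (1 - g), bcdf_succ K n₀ (1 - g)]
    ring
  have hconcF : ∀ K, K + 1 < m → F K - F (K + 1) ≤ F (K + 1) - F (K + 2) := by
    intro K hK
    rw [hdec K, hdec (K + 1)]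
    have hK' : ((K : ℝ) + 1) * (1 - g) ≤ n₀ := by
      have : ((K : ℝ) + 1) ≤ (m : ℝ) - 1 := by
        have : K + 2 ≤ m := hK
        have : ((K + 2 : ℕ) : ℝ) ≤ m := by exact_mod_cast this
        push_cast at this; linarith
      calc ((K : ℝ) + 1) * (1 - g) ≤ ((m : ℝ) - 1) * (1 - g) := mul_le_mul_of_nonneg_right this hgbar.le
        _ ≤ n₀ := by simpa [hm] using hconc
    have h1 : bpmf[K, n₀ + a, 1 - g] ≤ bpmf[K + 1, n₀ + a, 1 - g] :=
      bpmf_le_succ K (n₀ + a) hgbar.le (by linarith) (hK'.trans (by exact_mod_cast Nat.le_add_right n₀ a))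
    have h2 : bpmf[K, n₀, 1 - g] ≤ bpmf[K + 1, n₀, 1 - g] := bpmf_le_succ K n₀ hgbar.le (by linarith) hK'
    have := add_le_add (mul_le_mul_of_nonneg_left h1 hg0) (mul_le_mul_of_nonneg_left h2 hgbar.le)
    exact mul_le_mul_of_nonneg_left this hgbar.le
  -- chord: m F K ≥ (m - K) F 0 + K F m  for K ≤ m
  have hchord : ∀ K ∈ Finset.range (m + 1), ((m : ℝ) - K) + K * F m ≤ m * F K := by
    intro K hK
    rw [Finset.mem_range] at hK
    have := chord_of_concave F m hconcF K (by omega)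
    rw [hF0, mul_one] at this
    exact this
  -- average the chord against the Bin(m, lam) weights
  have hm1 : (1 : ℝ) ≤ m := by
    have : 1 ≤ m := by omega
    exact_mod_cast this
  have hmpos : (0 : ℝ) < m := by linarith
  have hsum1 : ∑ K ∈ Finset.range (m + 1), bpmf[m, K, lam] = 1 := bpmf_sum m lam
  have hmean : ∑ K ∈ Finset.range (m + 1), (K : ℝ) * bpmf[m, K, lam] = m * lam := bin_mean m lam
  have hw0 : ∀ K ∈ Finset.range (m + 1), 0 ≤ bpmf[m, K, lam] := fun K _ => bpmf_nonneg m K hlam0 hlam1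
  have key : (m : ℝ) * ∑ K ∈ Finset.range (m + 1), bpmf[m, K, lam] * F K ≥
      ∑ K ∈ Finset.range (m + 1), bpmf[m, K, lam] * (((m : ℝ) - K) + K * F m) := by
    rw [Finset.mul_sum]
    apply Finset.sum_le_sum
    intro K hK
    have := mul_le_mul_of_nonneg_left (hchord K hK) (hw0 K hK)
    linarith
  have hrhs : ∑ K ∈ Finset.range (m + 1), bpmf[m, K, lam] * (((m : ℝ) - K) + K * F m) = m - m * lam + m * lam * F m := by
    have : ∀ K ∈ Finset.range (m + 1), bpmf[m, K, lam] * (((m : ℝ) - K) + K * F m) =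
        (m : ℝ) * bpmf[m, K, lam] + (F m - 1) * ((K : ℝ) * bpmf[m, K, lam]) := by intro K _; ring
    rw [Finset.sum_congr rfl this, Finset.sum_add_distrib, ← Finset.mul_sum, ← Finset.mul_sum, hsum1, hmean]
    ring
  rw [hmix]
  -- m * P_u ≥ m - m lam + m lam F m ≥ m (1 - lam (1 - g)) = m u
  have h3 : (m : ℝ) * (1 - lam * (1 - F m)) ≤ m * ∑ K ∈ Finset.range (m + 1), bpmf[m, K, lam] * F K := by
    have := key; rw [hrhs] at this; linarith
  have h4 : 1 - lam * (1 - F m) ≤ ∑ K ∈ Finset.range (m + 1), bpmf[m, K, lam] * F K := le_of_mul_le_mul_left h3 hmpos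
  have h5 : u ≤ 1 - lam * (1 - F m) := by
    have : lam * (1 - F m) ≤ lam * (1 - g) := mul_le_mul_of_nonneg_left (by linarith) hlam0
    linarith
  exact h5.trans h4

/-- **Case A (big block).**  With `m = n₀ + s + 1` units and `g·m ≥ s`: for every `u ∈ [0,1]`,
`u ≤ g + (1−g)·P(Bin(m, 1−u) ≤ n₀)`  (the block alone exceeds the level, so only the block-closed fibre matters; Markov). -/
theorem row_caseA (n₀ s : ℕ) {g u : ℝ} (hg1 : g ≤ 1) (hu0 : 0 ≤ u) (hu1 : u ≤ 1)
    (hgm : (s : ℝ) ≤ g * (n₀ + s + 1 : ℕ)) :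
    u ≤ g + (1 - g) * bcdf[n₀ + s + 1, n₀, 1 - u] := by
  set m : ℕ := n₀ + s + 1 with hm
  have hmk := bin_markov m (n₀ + 1) (q := 1 - u) (by linarith) (by linarith) (by omega)
  rw [Nat.add_sub_cancel] at hmk
  -- hmk : (n₀+1) (1 - bcdf[m,n₀,ū]) ≤ m ū
  have hn : (0 : ℝ) < (n₀ + 1 : ℕ) := by positivity
  -- (1-g) (1 - bcdf) ≤ (1-g) m ū /(n₀+1) ≤ ū  since (1-g) m ≤ n₀ + 1 = m - s  ⟸ g m ≥ s
  have hkey : (1 - g) * (m : ℝ) ≤ (n₀ + 1 : ℕ) := by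
    have : (m : ℝ) = n₀ + s + 1 := by simp [hm]
    push_cast at hgm ⊢
    nlinarith
  have h1 : ((n₀ + 1 : ℕ) : ℝ) * ((1 - g) * (1 - bcdf[m, n₀, 1 - u])) ≤ ((n₀ + 1 : ℕ) : ℝ) * (1 - u) := by
    calc ((n₀ + 1 : ℕ) : ℝ) * ((1 - g) * (1 - bcdf[m, n₀, 1 - u]))
        = (1 - g) * (((n₀ + 1 : ℕ) : ℝ) * (1 - bcdf[m, n₀, 1 - u])) := by ring
      _ ≤ (1 - g) * ((m : ℝ) * (1 - u)) := mul_le_mul_of_nonneg_left hmk (by linarith)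
      _ = ((1 - g) * (m : ℝ)) * (1 - u) := by ring
      _ ≤ ((n₀ + 1 : ℕ) : ℝ) * (1 - u) := mul_le_mul_of_nonneg_right hkey (by linarith)
  have h2 : (1 - g) * (1 - bcdf[m, n₀, 1 - u]) ≤ 1 - u := le_of_mul_le_mul_left h1 hn
  linarith

/-! ### The N12 point, case C, and the assembled row -/

/-- **N12 at the all-`g` point.**  For the block-star 'a-blob at gate `g` + `m = n₀+s+1` units at gate `g`' with `2s < g(m+a)` and `a ≤ s`:
`g ≤ g·P(Bin(m,1−g) ≤ n₀+a) + (1−g)·P(Bin(m,1−g) ≤ n₀)` (= `P(count ≥ s+1) ≥ g`). From `Quant.IndepBlob.far_indepBlob`. -/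
theorem n12_point (n₀ s a : ℕ) (has : a ≤ s) {g : ℝ} (hg0 : 0 ≤ g) (hg1 : g ≤ 1)
    (hmean : (2 * s : ℝ) < g * ((n₀ + s + 1 : ℕ) + a)) :
    g ≤ g * bcdf[n₀ + s + 1, n₀ + a, 1 - g] + (1 - g) * bcdf[n₀ + s + 1, n₀, 1 - g] := by
  set m : ℕ := n₀ + s + 1 with hm
  have hfar := Quant.IndepBlob.far_indepBlob (ι := Fin m) (fun _ => g) (fun _ => (1 : ℝ)) g (a : ℝ) hg0 hg1
    (fun _ => le_rfl) (fun _ => hg1) (fun _ => zero_le_one) (Nat.cast_nonneg a) (s : ℝ)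
    (by simp only [mul_comm, Finset.sum_const, Finset.card_univ, Fintype.card_fin, nsmul_eq_mul]; linarith)
  -- rewrite the two filtered sums
  have hS : ∀ (c : ℕ), c + n₀ + 1 ≤ m →  -- threshold: #W + c ≤ s  ⟺  #W + (n₀ + c + 1) ≤ m
      ∑ W ∈ (Finset.univ : Finset (Finset (Fin m))).filter (fun W => ∑ i ∈ W, (1 : ℝ) + (c : ℝ) ≤ (s : ℝ)),
        (∏ k : Fin m, (if k ∈ W then g else 1 - g)) = 1 - bcdf[m, n₀ + c, 1 - g] := by
    intro c hc
    rw [Finset.sum_filter]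
    have : ∀ W ∈ (Finset.univ : Finset (Finset (Fin m))),
        (if ∑ i ∈ W, (1 : ℝ) + (c : ℝ) ≤ (s : ℝ) then (∏ k : Fin m, (if k ∈ W then g else 1 - g)) else 0) =
        (if #W + (n₀ + c + 1) ≤ m then g ^ #W * (1 - g) ^ (m - #W) else 0) := by
      intro W _
      have hcond : (∑ i ∈ W, (1 : ℝ) + (c : ℝ) ≤ (s : ℝ)) ↔ (#W + (n₀ + c + 1) ≤ m) := by
        rw [Finset.sum_const, nsmul_eq_mul, mul_one]
        constructor
        · intro h
          have h' : (#W : ℝ) + c ≤ s := h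
          have h'' : #W + c ≤ s := by exact_mod_cast h'
          omega
        · intro h
          have h' : #W + c ≤ s := by omega
          have h'' : (#W : ℝ) + c ≤ s := by exact_mod_cast h'
          exact h''
      rw [prod_ite_const]
      by_cases h : #W + (n₀ + c + 1) ≤ m
      · rw [if_pos (hcond.2 h), if_pos h]
      · rw [if_neg (fun h' => h (hcond.1 h')), if_neg h]
    rw [Finset.sum_congr rfl this]
    exact sum_weight_card_le m (n₀ + c) (by omega) g
  have hS1 := hS a (by omega)
  have hS0 := hS 0 (by omega)
  simp only [Nat.cast_zero, add_zero] at hS0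
  rw [hS1, hS0] at hfar
  -- hfar : g (1 - bcdf[m,n₀+a]) + (1-g)(1 - bcdf[m,n₀]) ≤ 1 - g
  linarith

/-- **Case C (the V97 shape `a = s`, `m = s+1`).**  For `g ≤ u ≤ 1` with `2s < g(2s+1)`:
`u ≤ g·P(Bin(s+1,1−u) ≤ s) + (1−g)·P(Bin(s+1,1−u) ≤ 0) = g(1 − (1−u)^{s+1}) + (1−g)u^{s+1}` (Bernoulli's inequality). -/
theorem row_caseC (s : ℕ) {g u : ℝ} (hgu : g ≤ u) (hu1 : u ≤ 1) (hmean : (2 * s : ℝ) < g * (2 * s + 1)) :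
    u ≤ g * bcdf[0 + s + 1, 0 + s, 1 - u] + (1 - g) * bcdf[0 + s + 1, 0, 1 - u] := by
  simp only [zero_add]
  have hg1 : g ≤ 1 := hgu.trans hu1
  have hgpos : 0 < g := by
    by_contra hneg
    have hneg' : g ≤ 0 := le_of_not_gt hneg
    have : g * (2 * (s : ℝ) + 1) ≤ 0 := mul_nonpos_of_nonpos_of_nonneg hneg' (by positivity)
    have : (0 : ℝ) ≤ 2 * s := by positivity
    linarith
  have hu0 : 0 ≤ u := by linarith
  have h0 : bcdf[s + 1, 0, 1 - u] = u ^ (s + 1) := by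
    simp [sub_sub_cancel]
  have hs' : bcdf[s + 1, s, 1 - u] = 1 - (1 - u) ^ (s + 1) := by
    have h := bcdf_self (s + 1) (1 - u)
    rw [Finset.sum_range_succ] at h
    have hlast : bpmf[s + 1, s + 1, 1 - u] = (1 - u) ^ (s + 1) := by simp
    rw [hlast] at h
    linarith
  rw [h0, hs']
  have hub : 0 ≤ 1 - u := by linarith
  -- Bernoulli: 1 - (s+1)(1-u) ≤ u^{s+1}
  have hB : 1 - ((s : ℝ) + 1) * (1 - u) ≤ u ^ (s + 1) := by
    have := one_add_mul_le_pow (show (-2 : ℝ) ≤ -(1 - u) by linarith) (s + 1)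
    have e : (1 : ℝ) + -(1 - u) = u := by ring
    rw [e] at this
    push_cast at this
    linarith
  rcases Nat.eq_zero_or_pos s with hs0 | hs0
  · subst hs0
    simp only [zero_add, pow_one] at *
    nlinarith
  · -- s ≥ 1: (1-u)^{s+1} ≤ (1-u)(1-g), and (1-g)(s+2) ≤ 1
    have hP : (1 - u) ^ (s + 1) ≤ (1 - u) * (1 - g) := by
      rw [pow_succ']
      apply mul_le_mul_of_nonneg_left _ hub
      calc (1 - u) ^ s ≤ (1 - g) ^ s := pow_le_pow_left₀ hub (by linarith) s
        _ ≤ (1 - g) ^ 1 := pow_le_pow_of_le_one (by linarith) (by linarith) hs0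
        _ = 1 - g := pow_one _
    have hs1 : (1 : ℝ) ≤ s := by exact_mod_cast hs0
    -- from 2s < g(2s+1): (1-g)(2s+1) < 1, and (s+2) ≤ (2s+1) gives (1-g)(s+2) < 1 ... we need (1-g)(g+s+1) ≤ 1
    have hgs : (1 - g) * ((s : ℝ) + 2) ≤ 1 := by nlinarith
    -- Φ ≥ g(1 - (1-u)(1-g)) + (1-g)(1 - (s+1)(1-u)) - u = (1-u)[1 - (1-g)(g + s + 1)] ≥ (1-u)[1 - (1-g)(s+2)] ≥ 0
    have hg0 : 0 ≤ g := by nlinarith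
    nlinarith [mul_nonneg hub (show 0 ≤ 1 - (1 - g) * ((s:ℝ) + 2) by linarith),
      mul_le_mul_of_nonneg_left hP hg0, mul_le_mul_of_nonneg_left hB (show 0 ≤ 1 - g by linarith)]

/-! ### The row, assembled -/

/-- **The discounted-hypothesis / upgraded-conclusion block-star row** (census-1 g7, Theorem 2 of
`prim-quant-census-1/FAR-LOOSE-HUB-ONE-BLOCK.md`), cases A and B.  Block-star: `c` glued units, an `a`-blob behind a gate of weight `g`,
`m` units behind gates of weight `u ≥ g`; if the mean computed with the units DISCOUNTED to `g` exceeds `2j`, i.e. `c + g(m+a) > 2j`,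
then `P(c + a·ε_g + Bin(m,u) ≥ j+1) ≥ u` — the NEXT gate, not the least gate `g` of N12.  Written with the closed count `Bin(m, 1−u)`:
`{count ≥ j+1} = {closed ≤ m−(j−c)−1 (+a if the blob is open)}`.  Cases: A (big blob, Markov), B (discrete concavity via the
gate mixture + N12 at the all-`g` point), C (the V97 shape `a = j−c`, `m = a+1`, Bernoulli's inequality). -/
theorem discounted_blockStar_row (m j c a : ℕ) {g u : ℝ} (hcj : c ≤ j) (haj : a ≤ j) (hg0 : 0 ≤ g) (hgu : g ≤ u)
    (hu1 : u ≤ 1) (hmean : (2 * j : ℝ) < c + g * (m + a)) :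
    u ≤ g * bcdf[m, m - (j - c) - 1 + a, 1 - u] + (1 - g) * bcdf[m, m - (j - c) - 1, 1 - u] := by
  have hg1 : g ≤ 1 := hgu.trans hu1
  set s : ℕ := j - c with hs
  have hjs : (j : ℝ) = s + c := by
    have : j = s + c := by omega
    rw [this]; push_cast; ring
  -- g(m+a) > 2s + c
  have hmean' : (2 * s : ℝ) + c < g * (m + a) := by rw [hjs] at hmean; linarith
  have hga : g * a ≤ a := by nlinarith [Nat.cast_nonneg (α := ℝ) a]
  have hgm1 : g * m ≤ m := by nlinarith [Nat.cast_nonneg (α := ℝ) m]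
  -- m ≥ s + 1
  have hms : s + 1 ≤ m := by
    have haj' : (a : ℝ) ≤ s + c := by rw [← hjs]; exact_mod_cast haj
    have : (s : ℝ) < m := by nlinarith
    have : s < m := by exact_mod_cast this
    omega
  -- n₀
  obtain ⟨n₀, hn₀⟩ : ∃ n₀, m = n₀ + s + 1 := ⟨m - s - 1, by omega⟩
  have e1 : m - (j - c) - 1 + a = n₀ + a := by omega
  have e2 : m - (j - c) - 1 = n₀ := by omega
  rw [e1, e2, hn₀]
  have hmR : (m : ℝ) = n₀ + s + 1 := by rw [hn₀]; push_cast; ring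
  by_cases hA : s + 1 ≤ a
  · -- case A: the blob alone exceeds the level
    have hfull : bcdf[n₀ + s + 1, n₀ + a, 1 - u] = 1 := bcdf_of_le _ _ _ (by omega)
    rw [hfull, mul_one]
    have hgm : (s : ℝ) ≤ g * (n₀ + s + 1 : ℕ) := by
      have haj' : (a : ℝ) ≤ s + c := by rw [← hjs]; exact_mod_cast haj
      have : (s : ℝ) ≤ g * m := by nlinarith
      rw [hmR] at this; push_cast; linarith
    exact row_caseA n₀ s hg1 (hg0.trans hgu) hu1 hgm
  · have has : a ≤ s := by omega
    by_cases hC : m ≤ a + 1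
    · -- case C: m = s + 1 = a + 1, so a = s and n₀ = 0
      have hn0 : n₀ = 0 := by omega
      have hsa : a = s := by omega
      subst hn0; rw [hsa]
      have hmean'' : (2 * s : ℝ) < g * (2 * s + 1) := by
        have : (m : ℝ) + a = 2 * s + 1 := by
          rw [hmR, hsa]; push_cast; ring
        rw [this] at hmean'
        have : (0:ℝ) ≤ c := Nat.cast_nonneg c
        linarith
      exact row_caseC s hgu hu1 hmean''
    -- case B: a ≤ s and m ≥ a + 2
    have hm2 : a + 2 ≤ m := by omega
    have hconc : ((n₀ + s + 1 : ℕ) - 1 : ℝ) * (1 - g) ≤ n₀ := by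
      -- (m-1) g ≥ s from g(m+a) > 2s and 2(m-1) ≥ m + a
      have h2 : (m : ℝ) + a ≤ 2 * ((m : ℝ) - 1) := by
        have : ((a + 2 : ℕ) : ℝ) ≤ m := by exact_mod_cast hm2
        push_cast at this; linarith
      have h3 : (s : ℝ) ≤ ((m : ℝ) - 1) * g := by nlinarith
      have hn₀R : (n₀ : ℝ) = m - s - 1 := by rw [hmR]; ring
      rw [← hn₀, hn₀R]
      nlinarith
    have hN12 := n12_point n₀ s a has hg0 hg1 (by rw [← hn₀]; linarith)
    exact row_caseB n₀ s a hg0 hgu hu1 hconc hN12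


end QuantCensus.DiscountRow

end Summit.CriticalPhenomena.PercolationContinuityZ3.Theorems
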